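import Literature.NumberTheory.EllipticCurves.PAdicLFunctionMomentProofs
import Literature.NumberTheory.EllipticCurves.LFunctionCoefficientBound
import Literature.NumberTheory.EllipticCurves.PAdicLFunctionNeZeroProofs
import Literature.NumberTheory.EllipticCurves.CuspFormLFunctionFrickeProofs
import Literature.NumberTheory.EllipticCurves.ModularSymbolsManin
import Literature.NumberTheory.EllipticCurves.ModularSymbolsManinDrinfeldProofs
import Literature.NumberTheory.EllipticCurves.ModularSymbolsRationalMinusPeriodsProofs
import HarnessLib

/-!
# `L_p(E, T) ≠ 0` from Eichler–Shimura alone (no Rohrlich, no Atkin–Lehner)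

Topic `NumberTheory/EllipticCurves` (trunk EllArithM; `padicLFunction_ne_zero` of
`PAdicLFunction`). `PAdicLFunctionNeZeroProofs.padicLFunction_ne_zero_of_lattice` reduced the
named fact `padicLFunction_ne_zero` (`L_p(E, T) ≠ 0` at a good ordinary prime) to two named
facts: Eichler–Shimura (`isZLattice_periodLattice`) and Rohrlich's non-vanishing theorem
(`Rohrlich1984_nonvanishing_twists`, Rohrlich 1984, Theorem p. 409). This file **removes
Rohrlich's theorem** from the hypotheses, replacing it by the first-moment non-vanishing theorem
`exists_wildChars_twistedSymbolSum_ne_zero` *proved* in `PAdicLFunctionMomentProofs`, applied to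
the Fricke pair `(f, w_N f)` — so that no `w_N`-eigen-property of the newform (Atkin–Lehner 1970,
Thm. 3) is needed either:

* `Literature.padicLFunction_ne_zero_of_isZLattice (hES : isZLattice_periodLattice) :
    padicLFunction_ne_zero` — **one named fact left**, Eichler–Shimura (`Λ_f` is a lattice);
* `Literature.padicLFunction_ne_zero_of_genus (h₁ : twelve_mul_finrank_cuspForm_two (Gamma0 N)) :
    padicLFunction_ne_zero` — the same from the dimension formula `dim S₂(Γ₀(N)) = g(X₀(N))`
  (Diamond–Shurman Thm. 3.5.1 with Thm. 3.1.1), through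
  `ModularSymbolsManin.isZLattice_periodLattice_of_genus`;
* `Literature.padicLFunction_ne_zero_of_genusX0_le (h : genusX0 N ≤ dim_ℂ S₂(Γ₀(N)))`,
  `Literature.padicLFunction_ne_zero_of_finrank_eq_genusX0 (h : finrank_cuspForm_two_eq_genusX0 N)` —
  what is left is exactly the existence of `g(X₀(N))` weight-`2` cusp forms (the Riemann–Roch half
  of Diamond–Shurman Thm. 3.5.1; Manin's bound and the integrality of the genus formula are
  theorems, `ModularCurveGenusIntegralityProofs`); and **unconditionally**
  `Literature.padicLFunction_ne_zero_of_genusX0_le_one (hg : genusX0 N ≤ 1)`,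
  `Literature.NumberTheory.EllipticCurves.padicLFunction_ne_zero_of_mem` — `L_p(E, T) ≠ 0` at the twenty-seven levels of genus
  `≤ 1`, in particular for the conductors `11, 14, 15, 17, 19, 20, 21, 24, 27, 32, 36, 49` (the
  newform itself witnesses `dim S₂(Γ₀(N)) ≥ 1 ≥ g`).

Also proved here: `isFrickePair_frickeInvolution` (`(f, w_N f)` is a Fricke pair, from
`frickeInvolution_apply_eq_slash_holds` of `CuspFormLFunctionFrickeProofs`: `w_N f = f ∣[2] w_N`
pointwise), its corollary `isFrickeEigen_of_frickeInvolution_eq_smul`, and `exists_ringHomComp_eq`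
(transport `ℚ̄ → ℂ` of Dirichlet characters is onto). Hecke's bound `|bₙ(w_N f)| ≤ C' n` is
`exists_norm_cuspCoeff_le_mul` of `ModularSymbolsManinDrinfeldProofs`.

Proof of `padicLFunction_ne_zero_of_isZLattice`. If `L_p(E, T) = 0`, the interpolation property
(`isPAdicLFunctionOf_padicLFunction_of_lattice`) kills `∑ χ(a)[a/p^m]⁺` for every wild character
`χ` of every conductor `p^m` over `ℂ_p`, hence (transport through `ℚ̄`, `exists_ringHomComp_eq`,
and Birch's formula) every twisted symbol sum `∑ χ(a){∞, a/p^m}_f` over `ℂ`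
(`twistedSymbolSum_eq_zero_of_padicLFunction_eq_zero`). But for `f` the newform of `E` and
`g = w_N f ∈ S_2(Γ₀(N))`: `(f, g)` is a Fricke pair, `a₁(f) = 1`,
`|aₙ(f)| = |aₙ(E)| ≤ 16^{256} n^{5/8}` (`LFunctionCoefficientBound`, Hasse at every prime),
`|bₙ(g)| ≤ C' n` (Hecke), and `p ∤ N` (`not_dvd_level_of_isNewformOf`); so
`exists_wildChars_twistedSymbolSum_ne_zero` produces, for `m` large, a wild character with
non-zero symbol sum — contradiction.

## References

* D. E. Rohrlich, *On `L`-functions of elliptic curves and cyclotomic towers*, Invent. Math. 75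
  (1984), 409–423.
* R. Greenberg, *Iwasawa theory for elliptic curves*, LNM 1716 (1999), §1.
* B. Mazur, J. Tate, J. Teitelbaum, Invent. Math. 84 (1986), §I.14.
* A. O. L. Atkin, J. Lehner, *Hecke operators on `Γ₀(m)`*, Math. Ann. 185 (1970), §2.
* F. Diamond, J. Shurman, *A first course in modular forms*, GTM 228 (2005), Thm. 3.1.1,
  Thm. 3.5.1, Prop. 5.9.1.
-/

noncomputable section

open scoped MatrixGroups ModularForm

open CongruenceSubgroup Filter Topology Literature.NumberTheory.EllipticCurves.ModularForms UpperHalfPlane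

namespace Literature.NumberTheory.EllipticCurves.ModularForms

/-! ### `(f, w_N f)` is a Fricke pair -/

section Fricke

open Matrix ModularGroup Matrix.SpecialLinearGroup

variable (N : ℕ) [NeZero N]

/-- **`(f, w_N f)` is a Fricke pair** for every `f ∈ S_2(Γ₀(N))`: `f(-1/(Nτ)) = N τ² (w_N f)(τ)`
for all `τ ∈ ℍ` — `w_N f = f ∣[2] w_N` pointwise (`frickeInvolution_apply_eq_slash_holds` of
`CuspFormLFunctionFrickeProofs`, the scalar `N^{1-k/2}` being `1` in weight `2`) and
`(f ∣[2] w_N)(τ) = N (Nτ)⁻² f(-1/(Nτ))`. No eigen-assumption on `f` (Atkin–Lehner 1970, §2).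
[cite: AtkinLehner1970, §2] -/
theorem isFrickePair_frickeInvolution (f : CuspForm (Gamma0 N) 2) :
    IsFrickePair N f (frickeInvolution N 2 f) := by
  intro τ
  set g : GL (Fin 2) ℝ := glCast (frickeGL N : GL (Fin 2) ℚ) with hg
  have hfun := frickeInvolution_apply_eq_slash_holds N 2 f
  have hτ := congr_fun hfun τ
  simp only [Pi.smul_apply, smul_eq_mul] at hτ
  rw [show (1 - ((2 : ℤ) : ℝ) / 2 : ℝ) = 0 by norm_num, Real.rpow_zero, Complex.ofReal_one,
    one_mul] at hτ
  -- evaluate the slash action at `τ`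
  have hdet : ((g.det : ℝˣ) : ℝ) = N := det_glCast_frickeGL N
  have hdetpos : 0 < ((g.det : ℝˣ) : ℝ) := by
    rw [hdet]; exact Nat.cast_pos.mpr (NeZero.pos N)
  have hdenom : denom g (τ : ℂ) = N * τ := by
    rw [denom, hg, val_glCast_frickeGL]; simp
  have hnum : num g (τ : ℂ) = -1 := by
    rw [num, hg, val_glCast_frickeGL]; simp
  have hpt : g • τ = frickePoint N τ := by
    ext1
    rw [coe_smul_of_det_pos hdetpos, hnum, hdenom, coe_frickePoint]
  have hσ : ∀ z : ℂ, σ g z = z := fun z ↦ by rw [hg]; exact σ_glCast _ z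
  have key := congr_fun (ModularForm.slash_def (k := 2) (⇑f) g) τ
  rw [← hg] at hτ
  rw [key] at hτ
  rw [hσ, hpt, hdet, hdenom, abs_of_nonneg (Nat.cast_nonneg N)] at hτ
  rw [_root_.zpow_neg, zpow_ofNat] at hτ
  norm_num at hτ
  have hN0 : (N : ℂ) ≠ 0 := Nat.cast_ne_zero.mpr (NeZero.ne N)
  have hτ0 : (τ : ℂ) ≠ 0 := UpperHalfPlane.ne_zero τ
  rw [hτ]
  field_simp

/-- **The pointwise Fricke eigen-property of a `w_N`-eigenform** (weight `2`): if
`w_N f = ε f` in `S_2(Γ₀(N))` then `f(-1/(Nτ)) = ε N τ² f(τ)` for all `τ ∈ ℍ` (the Fricke pair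
`(f, w_N f) = (f, ε f)`, `isFrickePair_smul_iff`; Atkin–Lehner 1970, §2).
[cite: AtkinLehner1970, §2] -/
theorem isFrickeEigen_of_frickeInvolution_eq_smul {f : CuspForm (Gamma0 N) 2} {ε : ℂ}
    (h : frickeInvolution N 2 f = ε • f) : IsFrickeEigen N f ε := by
  have hp := isFrickePair_frickeInvolution N f
  rw [h, CuspForm.IsGLPos.coe_smul] at hp
  exact isFrickePair_smul_iff.mp hp

end Fricke


/-! ### Surjectivity of the transport of Dirichlet characters from `ℚ̄` to `ℂ` -/

section Transport

/-- Every complex Dirichlet character is the transport of a `ℚ̄`-valued one along any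
embedding `ℚ̄ → ℂ` (both groups have `φ(n)` elements and the transport is injective). [folklore] -/
theorem exists_ringHomComp_eq (σ : AlgebraicClosure ℚ →+* ℂ) {n : ℕ} [NeZero n]
    (χ : DirichletCharacter ℂ n) :
    ∃ ψ : DirichletCharacter (AlgebraicClosure ℚ) n, ψ.ringHomComp σ = χ := by
  classical
  letI := Fintype.ofFinite (DirichletCharacter (AlgebraicClosure ℚ) n)
  letI := Fintype.ofFinite (DirichletCharacter ℂ n)
  have hinj : Function.Injective (fun ψ : DirichletCharacter (AlgebraicClosure ℚ) n ↦
      ψ.ringHomComp σ) := MulChar.injective_ringHomComp σ.injective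
  have hcard : Fintype.card (DirichletCharacter (AlgebraicClosure ℚ) n) =
      Fintype.card (DirichletCharacter ℂ n) := by
    rw [← Nat.card_eq_fintype_card, ← Nat.card_eq_fintype_card,
      DirichletCharacter.card_eq_totient_of_hasEnoughRootsOfUnity,
      DirichletCharacter.card_eq_totient_of_hasEnoughRootsOfUnity]
  have hbij := (Fintype.bijective_iff_injective_and_card _).mpr ⟨hinj, hcard⟩
  exact hbij.2 χ

end Transport

end Literature.NumberTheory.EllipticCurves.ModularForms

namespace Literature.NumberTheory.EllipticCurves

/-! ### `L_p(E, T) ≠ 0` -/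

section Final

open ModularForms

variable {N : ℕ} [NeZero N] {f : CuspForm (Gamma0 N) 2} {p : ℕ} [Fact p.Prime]
  {W : WeierstrassCurve ℚ} [W.IsGloballyMinimal] [W.IsElliptic]

/-- **Vanishing `L_p` kills all the twisted symbol sums at wild characters.** If `L_p(E, T) = 0`
(at a good ordinary `p`, `f` the newform of `E`, given Eichler–Shimura), then
`∑_a χ(a) {∞, a/p^m}_f = 0` for every `m ≥ 1` and every primitive even character `χ` mod `p^m`
of `p`-power order with values in `ℂ`: interpolation gives `∑ χ'(a)[a/p^m]⁺ = 0` over `ℂ_p`,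
transported to `ℂ` through `ℚ̄` (`exists_ringHomComp_eq`), and Birch's formula
(`ratTwistedSymbolSum_mul_plusPeriod_of_lattice`, `twisted_LValue_eq_holds`) turns this into the
vanishing of the symbol sum. [folklore] -/
theorem twistedSymbolSum_eq_zero_of_padicLFunction_eq_zero
    (hES : isZLattice_periodLattice (f := f)) (hord : IsOrdinaryAt W p) (hf : IsNewformOf W f)
    (hL0 : padicLFunction f (unitRoot W p : ℚ_[p]) = 0) {m : ℕ} (hm : 0 < m)
    {χ : DirichletCharacter ℂ (p ^ m)} (hχ : χ ∈ wildChars p m) : twistedSymbolSum f χ = 0 := by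
  have hp : p.Prime := Fact.out
  haveI : NeZero (p ^ m) := ⟨pow_ne_zero _ hp.ne_zero⟩
  have hQ : coeffField f = ⊥ := hf.coeffField_eq_bot
  have hMD := exists_nsmul_modularSymbol_mem_periodLattice_of_isNewformOf hf
  have hI := isPAdicLFunctionOf_padicLFunction_of_lattice (p := p) hES hord hf
  have hB := ratTwistedSymbolSum_mul_plusPeriod_of_lattice hES hMD
  have hU := unitRoot_spec_holds W p hord
  -- `α ≠ 0`
  have hα0 : ((unitRoot W p : ℤ_[p]) : ℚ_[p]) ≠ 0 := by
    rw [Ne, PadicInt.coe_eq_zero]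
    exact hU.2.ne_zero
  -- interpolation with `L_p = 0`
  have hvan : ∀ χ' : DirichletCharacter ℂ_[p] (p ^ m), χ'.IsPrimitive → χ'.Even →
      (∃ j : ℕ, orderOf χ' = p ^ j) → ratTwistedSymbolSum f χ' = 0 := by
    intro χ' hprim heven hord'
    have h := hI.2 m hm χ' hprim heven hord'
    rw [hL0] at h
    simp only [map_zero, zero_mul] at h
    have h0 := h.unique hasSum_zero
    exact (mul_eq_zero.mp h0).resolve_left
      ((_root_.map_ne_zero _).mpr (pow_ne_zero _ (inv_ne_zero hα0)))
  -- transport `ℂ ← ℚ̄ → ℂ_p`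
  obtain ⟨hprimC, hevenC, hordC⟩ := (mem_wildChars χ).mp hχ
  let K := AlgebraicClosure ℚ
  let σ : K →+* ℂ := (@IsAlgClosed.lift ℂ _ _ ℚ _ _ K _ _ (AlgebraicClosure.instAlgebra ℚ) _ _ _
    (AlgebraicClosure.isAlgebraic ℚ)).toRingHom
  let τ : K →+* ℂ_[p] := (@IsAlgClosed.lift ℂ_[p] _ _ ℚ _ _ K _ _
    (AlgebraicClosure.instAlgebra ℚ) _ _ _ (AlgebraicClosure.isAlgebraic ℚ)).toRingHom
  obtain ⟨ψ, hψ⟩ := exists_ringHomComp_eq σ χ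
  have hψprim : ψ.IsPrimitive := (isPrimitive_ringHomComp_iff σ ψ).mp (hψ ▸ hprimC)
  have hψeven : ψ.Even := (even_ringHomComp_iff σ ψ).mp (hψ ▸ hevenC)
  have hψord : ∃ j : ℕ, orderOf ψ = p ^ j := by rwa [← orderOf_ringHomComp σ ψ, hψ]
  have hzero : ratTwistedSymbolSum f χ = 0 := by
    have hτ0 : ratTwistedSymbolSum f (ψ.ringHomComp τ) = 0 :=
      hvan _ ((isPrimitive_ringHomComp_iff τ ψ).mpr hψprim)
        ((even_ringHomComp_iff τ ψ).mpr hψeven) (by rw [orderOf_ringHomComp]; exact hψord)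
    rw [ratTwistedSymbolSum_ringHomComp, map_eq_zero] at hτ0
    rw [← hψ, ratTwistedSymbolSum_ringHomComp, hτ0, map_zero]
  -- Birch: `(∑ χ(a)[a/m]⁺) Ω⁺ = τ(χ) L(f, χ⁻¹, 1)` and `τ(χ) L(f, χ⁻¹, 1) = ∑ χ(a){∞, a/m}`
  obtain ⟨L, hLd, hL⟩ := exists_differentiable_eq_twistedLSeries_holds f χ⁻¹
  have hBirch := hB hf.1 hQ hprimC hevenC hLd hL
  rw [hzero, zero_mul] at hBirch
  have hinvprim : DirichletCharacter.IsPrimitive χ⁻¹ := by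
    rw [DirichletCharacter.isPrimitive_def, DirichletCharacter.conductor_inv]; exact hprimC
  have hLV := twisted_LValue_eq_holds f hinvprim hLd hL
  rw [inv_inv] at hLV
  rw [← hLV, ← hBirch]

/-- **`L_p(E, T) ≠ 0` from Eichler–Shimura alone** (no Rohrlich, no Atkin–Lehner). At a good
ordinary prime `p`, for `f` the newform of `E = W / ℚ`: if `L_p(E, T) = 0` then all twisted symbol
sums `∑_a χ(a){∞, a/p^m}_f` at the wild characters of conductor `p^m` vanish
(`twistedSymbolSum_eq_zero_of_padicLFunction_eq_zero`), contradicting the non-vanishing of their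
first moment for large `m` (`exists_wildChars_twistedSymbolSum_ne_zero` for the Fricke pair
`(f, w_N f)` — `isFrickePair_frickeInvolution` — fed with `a₁ = 1`, the Ramanujan–Hasse bound
`norm_LFunction_le_rpow` for `f`, Hecke's bound `exists_norm_cuspCoeff_le_mul` for `w_N f`,
and `p ∤ N`). The only remaining input is `hES : isZLattice_periodLattice` (Eichler–Shimura:
`Λ_f` is a lattice), used for the rationality and the interpolation property of `L_p`. Compare
`PAdicLFunctionNeZeroProofs.padicLFunction_ne_zero_of_lattice`, whose second input was Rohrlich's
theorem `Rohrlich1984_nonvanishing_twists`. [folklore] -/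
theorem padicLFunction_ne_zero_of_isZLattice (hES : isZLattice_periodLattice (f := f)) :
    padicLFunction_ne_zero (f := f) (p := p) (W := W) := by
  intro hord hf hL0
  have hpN : ¬ p ∣ N := not_dvd_level_of_isNewformOf hf hord.1
  -- the inputs of the first-moment theorem for the Fricke pair `(f, w_N f)`
  have hW : IsFrickePair N f (frickeInvolution N 2 f) := isFrickePair_frickeInvolution N f
  have h1 : cuspCoeff f 1 = 1 := (isNormalized_iff_cuspCoeff_one f).mp hf.1.2.2
  have ha : ∀ n : ℕ, ‖cuspCoeff f n‖ ≤ (16 : ℝ) ^ 256 * (n : ℝ) ^ (5 / 8 : ℝ) := fun n ↦ by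
    rw [hf.2 n]; exact W.norm_LFunction_le_rpow n
  obtain ⟨C', hC', hb⟩ := exists_norm_cuspCoeff_le_mul (frickeInvolution N 2 f)
  have hb' : ∀ n : ℕ, ‖cuspCoeff (frickeInvolution N 2 f) n‖ ≤ C' * (n : ℝ) ^ (1 : ℝ) :=
    fun n ↦ by simpa only [Real.rpow_one] using hb n
  obtain ⟨m₀, hm₀⟩ := exists_wildChars_twistedSymbolSum_ne_zero f hW hpN (by positivity)
    (by norm_num) (by norm_num) hC'.le one_pos le_rfl ha hb' h1
  obtain ⟨χ, hχ, hne⟩ := hm₀ (max m₀ 1) (le_max_left _ _)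
  exact hne (twistedSymbolSum_eq_zero_of_padicLFunction_eq_zero hES hord hf hL0
    (lt_of_lt_of_le one_pos (le_max_right _ _)) hχ)

/-- **`L_p(E, T) ≠ 0` from the dimension formula `dim S₂(Γ₀(N)) = g(X₀(N))`**: the named fact
`padicLFunction_ne_zero` follows from the single named fact
`twelve_mul_finrank_cuspForm_two (Gamma0 N)` (Diamond–Shurman Thm. 3.5.1 with Thm. 3.1.1, the
genus/dimension formula for `X₀(N)`), through `isZLattice_periodLattice_of_genus`
(`ModularSymbolsManin`: `Λ_f` is a lattice from the rank of `H₁(X₀(N), ℤ)`) and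
`padicLFunction_ne_zero_of_isZLattice`. [cite: DiamondShurman2005, Thm. 3.5.1 with Thm. 3.1.1] -/
theorem padicLFunction_ne_zero_of_genus (h₁ : twelve_mul_finrank_cuspForm_two (Gamma0 N)) :
    padicLFunction_ne_zero (f := f) (p := p) (W := W) :=
  padicLFunction_ne_zero_of_isZLattice (isZLattice_periodLattice_of_genus h₁)

/-- **`L_p(E, T) ≠ 0` for a `w_N`-eigenform, from Eichler–Shimura** (kept for comparison with
the Atkin–Lehner route): the special case of `padicLFunction_ne_zero_of_isZLattice` in which one
happens to know `w_N f = ε f`; the hypothesis is now unused. [folklore] -/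
theorem padicLFunction_ne_zero_of_lattice_of_frickeEigen (hES : isZLattice_periodLattice (f := f))
    (_hfr : ∃ ε : ℂ, frickeInvolution N 2 f = ε • f) :
    padicLFunction_ne_zero (f := f) (p := p) (W := W) :=
  padicLFunction_ne_zero_of_isZLattice hES

/-! ### What remains: the existence of `g(X₀(N))` weight-`2` cusp forms; the levels of genus `≤ 1` -/

/-- **`L_p(E, T) ≠ 0` from the existence of `g(X₀(N))` cusp forms alone.** The Eichler–Shimura
input `isZLattice_periodLattice` of `padicLFunction_ne_zero_of_isZLattice` follows from
`genusX0 N ≤ dim_ℂ S₂(Γ₀(N))` (`isZLattice_periodLattice_of_genusX0_le`,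
`ModularCurveGenusIntegralityProofs`: Manin's bound `dim S₂(Γ₀(N)) ≤ g(X₀(N))` and the
integrality `12 ∣ 12 + μ − 3ν₂ − 4ν₃ − 6ν_∞` being theorems, only the Riemann–Roch existence half
of Diamond–Shurman Thm. 3.5.1 is left). So the named fact `padicLFunction_ne_zero` at level `N`
is reduced to exactly this inequality. [cite: DiamondShurman2005, Thm. 3.5.1] -/
theorem padicLFunction_ne_zero_of_genusX0_le
    (h : genusX0 N ≤ Module.finrank ℂ (CuspForm (Gamma0 N) 2)) :
    padicLFunction_ne_zero (f := f) (p := p) (W := W) :=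
  padicLFunction_ne_zero_of_isZLattice (isZLattice_periodLattice_of_genusX0_le N h)

/-- **`L_p(E, T) ≠ 0` from the dimension formula `dim_ℂ S₂(Γ₀(N)) = g(X₀(N))`** (the named fact
`finrank_cuspForm_two_eq_genusX0 N` of `ModularCurve`, Diamond–Shurman Thm. 3.5.1): the shape of
the final discharge — `padicLFunction_ne_zero_holds` is this theorem applied to
`finrank_cuspForm_two_eq_genusX0_holds N` once that fact is a theorem.
[cite: DiamondShurman2005, Thm. 3.5.1] -/
theorem padicLFunction_ne_zero_of_finrank_eq_genusX0 (h : finrank_cuspForm_two_eq_genusX0 N) :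
    padicLFunction_ne_zero (f := f) (p := p) (W := W) :=
  padicLFunction_ne_zero_of_genusX0_le ((finrank_cuspForm_two_eq_genusX0_iff_le N).mp h)

/-- **`L_p(E, T) ≠ 0` unconditionally at the levels of genus `≤ 1`.** If `genusX0 N ≤ 1` then
for every elliptic curve `E = W / ℚ` whose newform `f` has level `N` and every good ordinary prime
`p`, `L_p(E, T) ≠ 0`: the newform `f` is a nonzero weight-`2` cusp form on `Γ₀(N)`, so
`dim S₂(Γ₀(N)) ≥ 1 ≥ genusX0 N` supplies the existence half
(`IsNewform0.twelve_mul_finrank_cuspForm_two_of_genusX0_le_one`,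
`ModularSymbolsRationalMinusPeriodsProofs`). This covers the conductors
`11, 14, 15, 17, 19, 20, 21, 24, 27, 32, 36, 49` (`padicLFunction_ne_zero_of_mem`).
[cite: MazurTateTeitelbaum1986Invent, §I.14] -/
theorem padicLFunction_ne_zero_of_genusX0_le_one (hg : genusX0 N ≤ 1) :
    padicLFunction_ne_zero (f := f) (p := p) (W := W) := fun hord hf ↦
  padicLFunction_ne_zero_of_genus
    (IsNewform0.twelve_mul_finrank_cuspForm_two_of_genusX0_le_one hg hf.1) hord hf

/-- **`L_p(E, T) ≠ 0` at a good ordinary prime for (the newform of) an elliptic curve of level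
`N ∈ {1, …, 21, 24, 25, 27, 32, 36, 49}`**, the twenty-seven levels with `g(X₀(N)) ≤ 1`
(`genusX0_le_one_of_mem`; at the fifteen genus-`0` levels among them the statement is vacuous,
`S₂(Γ₀(N)) = 0` having no newform). In particular `L_p(E, T) ≠ 0` for every elliptic curve over
`ℚ` of conductor `11, 14, 15, 17, 19, 20, 21, 24, 27, 32, 36` or `49`, granted that its newform
has level equal to the conductor (Carayol), which is part of the hypothesis `IsNewformOf W f` only
through the level `N` of `f`. [cite: MazurTateTeitelbaum1986Invent, §I.14] -/
theorem padicLFunction_ne_zero_of_mem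
    (hN : N ∈ ({1, 2, 3, 4, 5, 6, 7, 8, 9, 10, 11, 12, 13, 14, 15, 16, 17, 18, 19, 20, 21, 24, 25,
      27, 32, 36, 49} : Finset ℕ)) :
    padicLFunction_ne_zero (f := f) (p := p) (W := W) :=
  padicLFunction_ne_zero_of_genusX0_le_one (genusX0_le_one_of_mem hN)

end Final

end Literature.NumberTheory.EllipticCurves
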